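import Summits.PneNP.PneNP.Theorems.PhaseTwinsPolyDepthTwinsAboveDefs

/-!
# Route PhaseTwins, crux `PolyDepthTwinsAbove` (stmt-PneNP-2719), line `parity-wired-ports`: stub `stub_maxDegree`

The parity-wired graph `pwGraph R W c` has maximum degree `≤ Δ` whenever `3 ≤ Δ`, the gadget `W.G` has
maximum degree `≤ d ≤ Δ`, the `V⁺`/`V⁻` ports have disjoint ranges and every port has `W.G`-degree `≤ d - 1`
(the analogue of `Literature.Computability.Complexity.degree_gadgetSubst_le` for this wiring). The three
kinds of vertices are bounded separately:
* a COPY vertex `(δ, a, x)` has its `W.G`-neighbours inside the copy (`W.G.degree x ≤ d` of them) and at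
  most ONE further neighbour — the pair partner `(δ, a + 1, x)` or the unique end plugged into `x` (unique
  since `W.Vp`, `W.slot` and `canonEnd R` are injective; not both, by `hVV` and the injectivity of
  `W.Vp ∘ W.slot`) — and such a further neighbour forces `x` to be a port, of `W.G`-degree `≤ d - 1`;
* an END vertex `(w, i, a, j)` has one copy neighbour and the inner neighbours `(w, S', j)` with
  `bit (c w) S' i = a`, at most two of them (a free coordinate injects the solution set into `ZMod 2`);
* an INNER vertex `(w, S', j)` has only the three end neighbours `(w, i, bit (c w) S' i, j)`, `i : Fin 3`.
-/

noncomputable section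

open scoped Classical BigOperators

namespace Summit.PneNP.PneNP.Cruxes.PolyDepthTwinsAbove.ParityWiredPorts

open Finset
open Literature.Computability.Complexity.Expander (RotGraph)
open Literature.ModelTheory.FiniteModelTheory.TseitinColouring (Dart)
open Literature.ModelTheory.FiniteModelTheory.CFIMatching (bit Canon zmod2_add_self)

set_option linter.dupNamespace false

variable {M v m κ₁ κ₂ : ℕ}

/-! ## Two small facts: `canonEnd` is injective, a CFI end has at most two inner neighbours -/

/-- `canonEnd R` is injective: two canonical darts with the same image are equal, two non-canonical ones
have the same reverse (and `R.rot` is an involution), and the side bit separates the mixed cases. -/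
theorem canonEnd_injective (R : RotGraph M 3) : Function.Injective (canonEnd R) := by
  intro δ δ' h
  unfold canonEnd at h
  split_ifs at h <;> simp only [Prod.mk.injEq] at h
  · exact h.1
  · exact absurd h.2 (by decide)
  · exact absurd h.2 (by decide)
  · have h' := congrArg R.rot h.1
    rwa [R.rot_rot, R.rot_rot] at h'

/-- For every dart index `i : Fin 3` and all `e a : ZMod 2`, at most two `S' : Fin 2 → ZMod 2` have
`bit e S' i = a`: the solution set injects into `ZMod 2` by reading off a free coordinate
(`S' 1` for `i = 0`, `S' 0` otherwise). -/
theorem card_filter_bit_le (e a : ZMod 2) (i : Fin 3) :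
    ((univ : Finset (Fin 2 → ZMod 2)).filter fun S' => bit e S' i = a).card ≤ 2 := by
  -- a coordinate that, together with the constraint, determines the solution
  suffices h : ∃ k : Fin 2, ∀ S T : Fin 2 → ZMod 2, bit e S i = a → bit e T i = a → S k = T k → S = T by
    obtain ⟨k, hk⟩ := h
    calc ((univ : Finset (Fin 2 → ZMod 2)).filter fun S' => bit e S' i = a).card
        ≤ (univ : Finset (ZMod 2)).card :=
          card_le_card_of_injOn (fun S => S k) (fun _ _ => mem_coe.2 (mem_univ _))
            fun S hS T hT hST => hk S T (mem_filter.1 (mem_coe.1 hS)).2 (mem_filter.1 (mem_coe.1 hT)).2 hST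
      _ = 2 := by rw [card_univ, ZMod.card]
  have two : ∀ S T : Fin 2 → ZMod 2, S 0 = T 0 → S 1 = T 1 → S = T := fun S T h0 h1 => by
    funext k
    fin_cases k
    · exact h0
    · exact h1
  unfold bit
  by_cases h0 : i = 0
  · refine ⟨1, fun S T hS hT hST => two S T ?_ hST⟩
    rw [if_pos h0] at hS hT
    exact hS.trans hT.symm
  · by_cases h1 : i = 1
    · refine ⟨0, fun S T hS hT hST => two S T hST ?_⟩
      rw [if_neg h0, if_pos h1] at hS hT
      exact hS.trans hT.symm
    · refine ⟨0, fun S T hS hT hST => two S T hST ?_⟩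
      rw [if_neg h0, if_neg h1] at hS hT
      have h := hS.trans hT.symm
      rw [hST] at h
      exact add_left_cancel h

/-! ## The neighbours of the three kinds of vertices -/

/-- The neighbours of a copy vertex `(δ, a, x)`: a `W.G`-neighbour in the same copy, the pair partner
`(δ, a + 1, x)` (only for canonical `δ` and `x` a port in a pair slot), or an end `(w, i, a, j)` plugged
into `x = V⁺(slot (side, j))` with `canonEnd R (w, i) = (δ, side)`. -/
theorem adj_copy {R : RotGraph M 3} {W : Wiring v m κ₁ κ₂} {c : Fin M → ZMod 2} {δ : Dart M 3} {a : ZMod 2}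
    {x : Fin v} {y : PWVert M v κ₂} (h : (pwGraph R W c).Adj (Sum.inl (δ, a, x)) y) :
    (∃ y', W.G.Adj x y' ∧ y = Sum.inl (δ, a, y')) ∨
    ((Canon R δ ∧ ∃ j : Fin κ₁, x = W.Vp (W.slot (Sum.inl j)) ∨ x = W.Vm (W.slot (Sum.inl j))) ∧
        y = Sum.inl (δ, a + 1, x)) ∨
    (∃ (w : Fin M) (i : Fin 3) (j : Fin κ₂), y = Sum.inr (Sum.inl (w, i, a, j)) ∧
        δ = (canonEnd R (w, i)).1 ∧ x = W.Vp (W.slot (Sum.inr ((canonEnd R (w, i)).2, j)))) := by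
  rw [pwGraph_adj] at h
  obtain ⟨-, h⟩ := h
  rcases y with ⟨δ', a', y'⟩ | ⟨w, i, a', j⟩ | ⟨w, S', j⟩
  · simp only [pwRel] at h
    rcases h with (⟨rfl, rfl, hadj⟩ | ⟨hc, rfl, rfl, j, hj⟩) | (⟨rfl, rfl, hadj⟩ | ⟨hc, rfl, ha, j, hj⟩)
    · exact Or.inl ⟨y', hadj, rfl⟩
    · rcases hj with ⟨rfl, rfl⟩ | ⟨rfl, rfl⟩
      · exact Or.inr (Or.inl ⟨⟨hc, j, Or.inl rfl⟩, rfl⟩)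
      · exact Or.inr (Or.inl ⟨⟨hc, j, Or.inr rfl⟩, rfl⟩)
    · exact Or.inl ⟨y', hadj.symm, rfl⟩
    · -- `a = a' + 1`, so the partner sits in copy `a' = a + 1`
      have ha' : a' = a + 1 := by rw [ha, add_assoc, zmod2_add_self, add_zero]
      rcases hj with ⟨rfl, rfl⟩ | ⟨rfl, rfl⟩
      · exact Or.inr (Or.inl ⟨⟨hc, j, Or.inl rfl⟩, by rw [ha']⟩)
      · exact Or.inr (Or.inl ⟨⟨hc, j, Or.inr rfl⟩, by rw [ha']⟩)
  · simp only [pwRel, false_or] at h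
    obtain ⟨rfl, hδ, hx⟩ := h
    exact Or.inr (Or.inr ⟨w, i, j, rfl, hδ, hx⟩)
  · simp only [pwRel, or_self] at h

/-- **Copy vertices have degree `≤ Δ`**: the `W.G`-neighbours of `x` in the copy, plus at most one further
neighbour (pair partner or plugged end), which moreover requires `x` to be a port. -/
theorem degree_copy_le {Δ d : ℕ} (R : RotGraph M 3) (W : Wiring v m κ₁ κ₂) (c : Fin M → ZMod 2)
    (hΔ : 1 ≤ Δ) (hd : d ≤ Δ) (hG : ∀ x, W.G.degree x ≤ d)
    (hVV : Disjoint (Set.range W.Vp) (Set.range W.Vm))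
    (hdp : ∀ i, W.G.degree (W.Vp i) ≤ d - 1) (hdm : ∀ i, W.G.degree (W.Vm i) ≤ d - 1)
    (δ : Dart M 3) (a : ZMod 2) (x : Fin v) :
    (pwGraph R W c).degree (Sum.inl (δ, a, x)) ≤ Δ := by
  -- the neighbours inside the copy
  set A : Finset (PWVert M v κ₂) := (W.G.neighborFinset x).map
    ⟨fun y' => Sum.inl (δ, a, y'), fun y₁ y₂ h => by simpa using h⟩ with hA
  set N : Finset (PWVert M v κ₂) := (pwGraph R W c).neighborFinset (Sum.inl (δ, a, x)) with hN
  have hAcard : A.card = W.G.degree x := by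
    rw [hA, card_map, SimpleGraph.card_neighborFinset_eq_degree]
  -- no vertex is both a `+`-port and a `−`-port
  have hpm : ∀ i i', W.Vp i ≠ W.Vm i' := fun i i' h =>
    Set.disjoint_left.1 hVV (Set.mem_range_self i) (h ▸ Set.mem_range_self i')
  -- the further neighbours: the pair partner or a plugged end
  have hout : ∀ y ∈ N \ A,
      ((Canon R δ ∧ ∃ j : Fin κ₁, x = W.Vp (W.slot (Sum.inl j)) ∨ x = W.Vm (W.slot (Sum.inl j))) ∧
          y = Sum.inl (δ, a + 1, x)) ∨
      (∃ (w : Fin M) (i : Fin 3) (j : Fin κ₂), y = Sum.inr (Sum.inl (w, i, a, j)) ∧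
          δ = (canonEnd R (w, i)).1 ∧ x = W.Vp (W.slot (Sum.inr ((canonEnd R (w, i)).2, j)))) := by
    intro y hy
    rw [mem_sdiff, hN, SimpleGraph.mem_neighborFinset] at hy
    rcases adj_copy hy.1 with ⟨y', hadj, rfl⟩ | h | h
    · exact absurd (mem_map.2 ⟨y', (SimpleGraph.mem_neighborFinset _ _ _).2 hadj, rfl⟩) hy.2
    · exact Or.inl h
    · exact Or.inr h
  -- hence at most one of them
  have hcard : (N \ A).card ≤ 1 := by
    refine card_le_one.2 fun y hy y' hy' => ?_
    rcases hout y hy with ⟨⟨-, j₀, hj₀⟩, rfl⟩ | ⟨w, i, j, rfl, hδ, hx⟩ <;>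
      rcases hout y' hy' with ⟨⟨-, j₀', hj₀'⟩, rfl⟩ | ⟨w', i', j', rfl, hδ', hx'⟩
    · rfl
    · -- pair partner and plugged end: `x` would sit in a pair slot and in an end slot
      exfalso
      rcases hj₀ with h | h
      · exact absurd (W.slot.injective (W.Vp.injective (h.symm.trans hx'))) Sum.inl_ne_inr
      · exact hpm _ _ (hx'.symm.trans h)
    · exfalso
      rcases hj₀' with h | h
      · exact absurd (W.slot.injective (W.Vp.injective (h.symm.trans hx))) Sum.inl_ne_inr
      · exact hpm _ _ (hx.symm.trans h)
    · -- two ends plugged into `x`: same slot, hence same side and index, hence the same dart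
      have hk := W.slot.injective (W.Vp.injective (hx.symm.trans hx'))
      simp only [Sum.inr.injEq, Prod.mk.injEq] at hk
      have hwi := canonEnd_injective R (Prod.ext (hδ.symm.trans hδ') hk.1)
      simp only [Prod.mk.injEq] at hwi
      obtain ⟨rfl, rfl⟩ := hwi
      rw [hk.2]
  have hdeg : (pwGraph R W c).degree (Sum.inl (δ, a, x)) ≤ (N \ A).card + W.G.degree x := by
    rw [← SimpleGraph.card_neighborFinset_eq_degree, ← hAcard]
    exact card_le_card_sdiff_add_card
  rcases (N \ A).eq_empty_or_nonempty with h0 | ⟨y, hy⟩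
  · -- no further neighbour
    rw [h0, card_empty, zero_add] at hdeg
    exact hdeg.trans ((hG x).trans hd)
  · -- a further neighbour: `x` is a port, of `W.G`-degree `≤ d - 1`
    have hx : W.G.degree x ≤ d - 1 := by
      rcases hout y hy with ⟨⟨-, j, rfl | rfl⟩, -⟩ | ⟨w, i, j, -, -, rfl⟩
      · exact hdp _
      · exact hdm _
      · exact hdp _
    omega

/-- **End vertices have degree `≤ 3`**: the copy vertex the end plugs into, and the inner vertices
`(w, S', j)` with `bit (c w) S' i = a` (at most two). -/
theorem degree_end_le (R : RotGraph M 3) (W : Wiring v m κ₁ κ₂) (c : Fin M → ZMod 2) (w : Fin M)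
    (i : Fin 3) (a : ZMod 2) (j : Fin κ₂) :
    (pwGraph R W c).degree (Sum.inr (Sum.inl (w, i, a, j))) ≤ 3 := by
  -- the copy neighbour and the inner neighbours
  set C : PWVert M v κ₂ :=
    Sum.inl ((canonEnd R (w, i)).1, a, W.Vp (W.slot (Sum.inr ((canonEnd R (w, i)).2, j)))) with hC
  set I : Finset (PWVert M v κ₂) :=
    ((univ : Finset (Fin 2 → ZMod 2)).filter fun S' => bit (c w) S' i = a).image
      fun S' => Sum.inr (Sum.inr (w, S', j)) with hI
  have hsub : (pwGraph R W c).neighborFinset (Sum.inr (Sum.inl (w, i, a, j))) ⊆ insert C I := by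
    intro y hy
    rw [SimpleGraph.mem_neighborFinset, pwGraph_adj] at hy
    obtain ⟨-, hy⟩ := hy
    rcases y with ⟨δ', a', y'⟩ | ⟨w', i', a', j'⟩ | ⟨w', S', j'⟩
    · simp only [pwRel, or_false] at hy
      obtain ⟨ha, hδ, hy'⟩ := hy
      rw [ha, hδ, hy']
      exact mem_insert_self _ _
    · simp only [pwRel, or_self] at hy
    · simp only [pwRel, false_or] at hy
      obtain ⟨hw, hj, hb⟩ := hy
      rw [← hw, ← hj]
      rw [← hw] at hb
      exact mem_insert_of_mem (mem_image.2 ⟨S', mem_filter.2 ⟨mem_univ _, hb⟩, rfl⟩)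
  have hIcard : I.card ≤ 2 := card_image_le.trans (card_filter_bit_le (c w) a i)
  calc (pwGraph R W c).degree (Sum.inr (Sum.inl (w, i, a, j)))
      = ((pwGraph R W c).neighborFinset (Sum.inr (Sum.inl (w, i, a, j)))).card :=
        (SimpleGraph.card_neighborFinset_eq_degree _ _).symm
    _ ≤ (insert C I).card := card_le_card hsub
    _ ≤ I.card + 1 := card_insert_le _ _
    _ ≤ 3 := by omega

/-- **Inner vertices have degree `≤ 3`**: the only neighbours of `(w, S', j)` are the three ends
`(w, i, bit (c w) S' i, j)`, `i : Fin 3`. -/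
theorem degree_inner_le (R : RotGraph M 3) (W : Wiring v m κ₁ κ₂) (c : Fin M → ZMod 2) (w : Fin M)
    (S' : Fin 2 → ZMod 2) (j : Fin κ₂) :
    (pwGraph R W c).degree (Sum.inr (Sum.inr (w, S', j))) ≤ 3 := by
  set E : Finset (PWVert M v κ₂) :=
    (univ : Finset (Fin 3)).image fun i => Sum.inr (Sum.inl (w, i, bit (c w) S' i, j)) with hE
  have hsub : (pwGraph R W c).neighborFinset (Sum.inr (Sum.inr (w, S', j))) ⊆ E := by
    intro y hy
    rw [SimpleGraph.mem_neighborFinset, pwGraph_adj] at hy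
    obtain ⟨-, hy⟩ := hy
    rcases y with ⟨δ', a', y'⟩ | ⟨w', i', a', j'⟩ | ⟨w', S'', j'⟩
    · simp only [pwRel, or_self] at hy
    · simp only [pwRel, or_false] at hy
      obtain ⟨hw, hj, hb⟩ := hy
      rw [hw, hj, ← hb]
      exact mem_image.2 ⟨i', mem_univ _, rfl⟩
    · simp only [pwRel, or_self] at hy
  calc (pwGraph R W c).degree (Sum.inr (Sum.inr (w, S', j)))
      = ((pwGraph R W c).neighborFinset (Sum.inr (Sum.inr (w, S', j)))).card :=
        (SimpleGraph.card_neighborFinset_eq_degree _ _).symm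
    _ ≤ E.card := card_le_card hsub
    _ ≤ (univ : Finset (Fin 3)).card := card_image_le
    _ = 3 := by rw [card_univ, Fintype.card_fin]

/-! ## The stub -/

/-- **S3 — the parity-wired graph has maximum degree `≤ Δ`.** If `3 ≤ Δ`, the gadget has maximum degree
`≤ d ≤ Δ`, the `V⁺`/`V⁻` ports have disjoint ranges and every port has gadget-degree `≤ d - 1`, then every
vertex of `pwGraph R W c` has degree `≤ Δ`: copy vertices by `degree_copy_le` (gadget neighbours plus at most
one pair/end edge, and only at a port), end vertices by `degree_end_le` (`1 + 2 ≤ 3`), inner vertices by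
`degree_inner_le` (`3`). The analogue of `Literature.Computability.Complexity.maxDegree_gadgetSubst_le`. -/
theorem stub_maxDegree {Δ d : ℕ} (R : RotGraph M 3) (W : Wiring v m κ₁ κ₂) (c : Fin M → ZMod 2)
    (hΔ : 3 ≤ Δ) (hd : d ≤ Δ) (hG : W.G.maxDegree ≤ d)
    (hVV : Disjoint (Set.range W.Vp) (Set.range W.Vm))
    (hdp : ∀ i, W.G.degree (W.Vp i) ≤ d - 1) (hdm : ∀ i, W.G.degree (W.Vm i) ≤ d - 1) :
    (pwGraph R W c).maxDegree ≤ Δ := by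
  refine SimpleGraph.maxDegree_le_of_forall_degree_le _ _ fun z => ?_
  rcases z with ⟨δ, a, x⟩ | ⟨w, i, a, j⟩ | ⟨w, S', j⟩
  · exact degree_copy_le R W c (le_trans (by norm_num) hΔ) hd
      (fun x => (W.G.degree_le_maxDegree x).trans hG) hVV hdp hdm δ a x
  · exact (degree_end_le R W c w i a j).trans hΔ
  · exact (degree_inner_le R W c w S' j).trans hΔ

end Summit.PneNP.PneNP.Cruxes.PolyDepthTwinsAbove.ParityWiredPorts
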